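import Summits.ABC.StewartYu.PadicG3ParB
import HarnessLib

/-!
# The `p`-adic Gen-3 parameter record — v2 closed forms `…G` (the gain-divided schedule; K-M3.2)

Support file (plain definitions and elementary theorems; no named facts), on the SAME data structure
`PadicG3Par n` as v1 (`PadicG3Par.lean`, p474824) — every v1 lemma about the data and about `m, θ_m, G, K`
is reused, nothing is restated. Design page HOME/p1/K-M3.2-m0-branch.md (plan g8 ruling 2026-08-27T02:40:45Z
(1): «record v2 = `PadicG3ParG`, multiplicity ÷ g, `T_s` floored at 1, `X_s` doubling every level, `L₀/L ÷ gⁿ`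
with no `2^Ŝ·N_q` floor, `Ŝ + ⌈log₂ g⌉`, END multiplicity = reserved floor `M/(n+2)³`; ONE record for all odd p»).

THE v2 FAMILY (print: Yu 2013 §3.1 Thm I ledger — multiplicity divided by the gain, `T ∝ D/(θ log p)`):
* `g = G/(c_G (n+1)) ≥ 1` — the EXCESS GAIN (`= 1`-ish at `m ≥ 1`, `= θ₀ log p/(8(n+1))` at `m = 0`);
  `lgg = ⌈log₂ ⌈g⌉⌉`, depth `ŜG = n + 24 + ⌊log₂ N_q⌋ + lgg`;
* box scale `LG = max(⌈24 C_bⁿ Ω K · yloadG/(G·gⁿ)⌉, 2^{n+25}, ⌈2 Amax⌉)` (Siegel ÷ gⁿ; NO `2^Ŝ N_q` branch);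
  gain-divided scale `Lg = max(⌈LG/g⌉, 2^{n+25})`; multiplicity `MG = 16 (n+1) Lg`; decrement
  `TG s = max 1 (8 Lg/2^s)` (FLOORED at 1); points `XG = max(⌈64(n+1) W_LG/G⌉, ⌈(3/2)(n+1) Lg gⁿ/(C_bⁿ Ω K)⌉, 64(n+1))`;
  range `XsG s = ⌊2^s G XG/(16(n+1))⌋ + 1 ≍ 2^{s−1} g XG` (doubling at EVERY level); `Y₀`-degree
  `L₀G = ⌈6 XG C_bⁿ Ω K/gⁿ⌉`; Feldman block `HG = max 1 ⌊G XG/(64(n+1))⌋`;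
* orders: remaining decrements `RG s = Σ_{s' ∈ [s, ŜG]} TG s'`, `MordG s ν = MG/(n+2)³ + (n+1)·RG (s+1) + (n+1−ν)·TG s`
  (exact decrement law `MordG s ν = MordG s (ν+1) + TG s`, level law `MordG s (n+1) = MordG (s+1) 0` for `s < ŜG`);
* END data `D₀G = L₀G + 1`, `DG j = ⌊N_q LG/(2^{ŜG} A j)⌋ + 1`, `XfinG = 2ⁿ XsG ŜG/(n+1)`, `S₀NG = MG/(n+2)⁴`,
  `κEG = 2^{n+25} g/LG`.

## References
* [Nesterenko2003] Yu. V. Nesterenko, *Linear forms in logarithms of rational numbers*, LNM 1819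
  (2003) 53–106 — (3.23), (4.3)–(4.5), (5.6)–(5.8).
* [Yu2013] K. Yu, *p-adic logarithmic forms and a problem of Erdős*, Acta Math. 211 (2013) — §3.1 (3.1)–(3.9)
  (T = q(r+1)D/(c₁θ e_𝔭 f_𝔭 log p): multiplicity divided by the gain), (5.13)–(5.16).
-/

noncomputable section

open Finset Real

namespace Summit.ABC.StewartYu

namespace PadicG3Par

variable {n : ℕ} (P : PadicG3Par n)

/-! ### The excess gain and the depth -/

/-- the EXCESS GAIN `g = G/(c_G (n+1))` (`≥ 1`; `= θ₀ log p/(8(n+1))` when `m = 0`). [cite: Yu2013, (3.5)] -/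
def g : ℝ := P.G / (cG * (n + 1))

/-- `⌈g⌉`. [folklore] -/
def gceil : ℕ := ⌈P.g⌉₊

/-- `lgg = ⌈log₂ ⌈g⌉⌉` (so `g ≤ 2^{lgg}`). [folklore] -/
def lgg : ℕ := Nat.clog 2 P.gceil

/-- the v2 depth `ŜG = n + 24 + ⌊log₂ N_q⌋ + lgg`. [cite: Nesterenko2003, (3.24)] -/
def SdG : ℕ := n + 24 + Nat.log 2 P.Nq + P.lgg

/-- the v2 `Y₀`-load `yloadG = G + 2 log p + (ŜG + n + 1) log 2 + log(n+1) + 8`. [folklore] -/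
def yloadG : ℝ := P.G + 2 * Real.log P.p + (P.SdG + n + 1) * Real.log 2 + Real.log (n + 1) + 8

/-! ### The scales -/

/-- the v2 box scale `LG = max(⌈24 C_bⁿ Ω K yloadG/(G gⁿ)⌉, 2^{n+25}, ⌈2 Amax⌉)` (Siegel term ÷ gⁿ; no
`2^Ŝ N_q` branch). [cite: Yu2013, (3.4)] -/
def LG : ℕ := max (max ⌈24 * Cb ^ n * P.Ω * P.K * P.yloadG / (P.G * P.g ^ n)⌉₊ (2 ^ (n + 25))) ⌈2 * P.Amax⌉₊

/-- the GAIN-DIVIDED scale `Lg = max(⌈LG/g⌉, 2^{n+25})` (multiplicity unit). [cite: Yu2013, (3.5)] -/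
def Lg : ℕ := max ⌈(P.LG : ℝ) / P.g⌉₊ (2 ^ (n + 25))

/-- the v2 total multiplicity `MG = 16 (n+1) Lg`. [cite: Nesterenko2003, Prop 3.9] -/
def MG : ℕ := 16 * (n + 1) * P.Lg

/-- the v2 decrement `TG s = max 1 (8 Lg/2^s)` — FLOORED at `1`. [cite: Yu2013, (5.15)–(5.16)] -/
def TG (s : ℕ) : ℕ := max 1 (8 * P.Lg / 2 ^ s)

/-- the v2 size logarithm `W_LG = log(e (1 + 2 e^W LG))`. [cite: Nesterenko2003, (3.37)] -/
def WLG : ℝ := Real.log (Real.exp 1 * (1 + 2 * Real.exp P.W * P.LG))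

/-- the v2 number of points `XG = max(⌈64 (n+1) W_LG/G⌉, ⌈(3/2)(n+1) Lg gⁿ/(C_bⁿ Ω K)⌉, 64(n+1))`.
[cite: Nesterenko2003, Prop 3.9] -/
def XG : ℕ :=
  max (max ⌈64 * (n + 1) * P.WLG / P.G⌉₊ ⌈(3 / 2) * (n + 1) * P.Lg * P.g ^ n / (Cb ^ n * P.Ω * P.K)⌉₊) (64 * (n + 1))

/-- the v2 range at level `s`: `XsG s = ⌊2^s G XG/(16(n+1))⌋ + 1 ≍ 2^{s−1} g XG` (doubling at every level).
[cite: Nesterenko2003, (4.3)] -/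
def XsG (s : ℕ) : ℕ := ⌊(2 : ℝ) ^ s * P.G * P.XG / (16 * (n + 1))⌋₊ + 1

/-- the v2 `Y₀`-degree `L₀G = ⌈6 XG C_bⁿ Ω K/gⁿ⌉` (Siegel ÷ gⁿ). [cite: Yu2013, (3.7)] -/
def L0G : ℕ := ⌈6 * P.XG * Cb ^ n * P.Ω * P.K / P.g ^ n⌉₊

/-- the v2 Feldman block `HG = max 1 ⌊G XG/(64 (n+1))⌋`. [cite: Nesterenko2003, (3.23)] -/
def HG : ℕ := max 1 ⌊P.G * P.XG / (64 * (n + 1))⌋₊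

/-! ### The orders -/

/-- remaining decrements from level `s` to the END: `RG s = Σ_{s' ∈ [s, ŜG]} TG s'`. [cite: Nesterenko2003, (4.5)] -/
def RG (s : ℕ) : ℕ := ∑ s' ∈ Finset.Icc s P.SdG, P.TG s'

/-- the v2 order at stage `(s, ν)`: `MordG s ν = MG/(n+2)³ + (n+1)·RG (s+1) + (n+1−ν)·TG s`.
[cite: Nesterenko2003, (4.5)] -/
def MordG (s ν : ℕ) : ℕ := P.MG / (n + 2) ^ 3 + (n + 1) * P.RG (s + 1) + (n + 1 - ν) * P.TG s

/-! ### The END data -/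

/-- `D₀G = L₀G + 1`. [cite: Nesterenko2003, §5.2] -/
def D0G : ℕ := P.L0G + 1

/-- `DG j = ⌊N_q LG/(2^{ŜG} A j)⌋ + 1`. [cite: Nesterenko2003, §5.2] -/
def DG (j : Fin n) : ℕ := ⌊(P.Nq : ℝ) * P.LG / (2 ^ P.SdG * P.A j)⌋₊ + 1

/-- `XfinG = 2ⁿ XsG ŜG/(n+1)`. [cite: Nesterenko2003, §5.2] -/
def XfinG : ℕ := 2 ^ n * P.XsG P.SdG / (n + 1)

/-- `S₀NG = MG/(n+2)⁴`. [cite: Nesterenko2003, (5.8)] -/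
def S0NG : ℕ := P.MG / (n + 2) ^ 4

/-- the v2 exit-C scale `κEG = 2^{n+25} g/LG`. [cite: Nesterenko2003, §5.2] -/
def κEG : ℝ := 2 ^ (n + 25) * P.g / P.LG

/-! ### Elementary facts: the excess gain -/

/-- `G = 8 (n+1) g`. [folklore] -/
theorem G_eq_mul_g : P.G = 8 * (n + 1) * P.g := by
  unfold g cG; field_simp

/-- **`1 ≤ g`** (`G ≥ c_G (n+1)`, v1 `cG_mul_le_G`). [folklore] -/
theorem one_le_g : 1 ≤ P.g := by
  unfold g
  rw [le_div_iff₀ (by unfold cG; positivity)]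
  have := P.cG_mul_le_G; linarith

/-- `g ≤ ⌈g⌉ ≤ 2^{lgg}`. [folklore] -/
theorem g_le_two_pow_lgg : P.g ≤ 2 ^ P.lgg := by
  have h1 : P.g ≤ P.gceil := Nat.le_ceil _
  have h2 : P.gceil ≤ 2 ^ P.lgg := Nat.le_pow_clog (by norm_num) _
  calc P.g ≤ P.gceil := h1
    _ ≤ ((2 ^ P.lgg : ℕ) : ℝ) := by exact_mod_cast h2
    _ = 2 ^ P.lgg := by push_cast; ring

/-- `2^{ŜG} ≤ 2^{n+24} N_q 2^{lgg}`. [cite: Nesterenko2003, (5.6)] -/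
theorem two_pow_SdG_le : 2 ^ P.SdG ≤ 2 ^ (n + 24) * P.Nq * 2 ^ P.lgg := by
  unfold SdG
  rw [pow_add, pow_add]
  exact Nat.mul_le_mul_right _
    (Nat.mul_le_mul_left _ (Nat.pow_log_le_self 2 (by have := P.hNq; omega)))

/-- `v1`'s depth is below the v2 depth: `Ŝ ≤ ŜG`. [folklore] -/
theorem Sdepth_le_SdG : P.Sdepth ≤ P.SdG := by unfold Sdepth SdG; omega

/-! ### Elementary facts: the scales -/

/-- `G ≤ yloadG`. [folklore] -/
theorem G_le_yloadG : P.G ≤ P.yloadG := by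
  unfold yloadG
  have h1 : 0 ≤ Real.log P.p := P.log_p_pos.le
  have h2 : 0 ≤ ((P.SdG : ℝ) + n + 1) * Real.log 2 := by
    have : 0 ≤ Real.log 2 := Real.log_nonneg (by norm_num); positivity
  have h3 : 0 ≤ Real.log ((n : ℝ) + 1) := Real.log_nonneg (by linarith [(Nat.cast_nonneg n : (0:ℝ) ≤ n)])
  linarith

/-- `0 < yloadG`. [folklore] -/
theorem yloadG_pos : 0 < P.yloadG := lt_of_lt_of_le (by linarith [P.eight_le_G]) P.G_le_yloadG

/-- `2^{n+25} ≤ LG`. [folklore] -/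
theorem two_pow_le_LG : 2 ^ (n + 25) ≤ P.LG := by
  unfold LG; exact le_trans (le_max_right _ _) (le_max_left _ _)

/-- `1 ≤ LG` (real). [folklore] -/
theorem one_le_LG : (1 : ℝ) ≤ P.LG := by
  have h : 1 ≤ P.LG := le_trans Nat.one_le_two_pow P.two_pow_le_LG
  exact_mod_cast h

/-- `2 Amax ≤ LG`. [folklore] -/
theorem two_Amax_le_LG : 2 * P.Amax ≤ P.LG := by
  have h : (⌈2 * P.Amax⌉₊ : ℝ) ≤ P.LG := by unfold LG; exact_mod_cast le_max_right _ _
  exact (Nat.le_ceil _).trans h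

/-- the Siegel term of `LG`: `24 C_bⁿ Ω K yloadG/(G gⁿ) ≤ LG`. [folklore] -/
theorem mainG_le_LG : 24 * Cb ^ n * P.Ω * P.K * P.yloadG / (P.G * P.g ^ n) ≤ P.LG := by
  have h : (⌈24 * Cb ^ n * P.Ω * P.K * P.yloadG / (P.G * P.g ^ n)⌉₊ : ℝ) ≤ P.LG := by
    unfold LG; exact_mod_cast le_trans (le_max_left _ _) (le_max_left _ _)
  exact (Nat.le_ceil _).trans h

/-- `2^{n+25} ≤ Lg`. [folklore] -/
theorem two_pow_le_Lg : 2 ^ (n + 25) ≤ P.Lg := by unfold Lg; exact le_max_right _ _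

/-- `1 ≤ Lg` (real). [folklore] -/
theorem one_le_Lg : (1 : ℝ) ≤ P.Lg := by
  have h : 1 ≤ P.Lg := le_trans Nat.one_le_two_pow P.two_pow_le_Lg
  exact_mod_cast h

/-- `LG/g ≤ Lg`. [folklore] -/
theorem LG_div_g_le_Lg : (P.LG : ℝ) / P.g ≤ P.Lg := by
  have h : (⌈(P.LG : ℝ) / P.g⌉₊ : ℝ) ≤ P.Lg := by unfold Lg; exact_mod_cast le_max_left _ _
  exact (Nat.le_ceil _).trans h

/-- `LG ≤ g · Lg`. [folklore] -/
theorem LG_le_g_mul_Lg : (P.LG : ℝ) ≤ P.g * P.Lg := by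
  have h := P.LG_div_g_le_Lg
  rw [div_le_iff₀ (lt_of_lt_of_le one_pos P.one_le_g)] at h; linarith

/-- `Lg ≤ LG` (as `g ≥ 1` and `2^{n+25} ≤ LG`). [folklore] -/
theorem Lg_le_LG : P.Lg ≤ P.LG := by
  unfold Lg
  refine max_le ?_ P.two_pow_le_LG
  have h : (P.LG : ℝ) / P.g ≤ P.LG := div_le_self (by positivity) P.one_le_g
  exact Nat.ceil_le.mpr (by exact_mod_cast h)

/-- `MG = 16 (n+1) Lg`. [folklore] -/
theorem MG_eq : P.MG = 16 * (n + 1) * P.Lg := rfl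

/-! ### Elementary facts: the schedule -/

/-- `1 ≤ TG s` at EVERY level (the floor). [cite: Yu2013, (5.15)] -/
theorem one_le_TG (s : ℕ) : 1 ≤ P.TG s := by unfold TG; exact le_max_left _ _

/-- `TG s ≤ 8 Lg`. [folklore] -/
theorem TG_le (s : ℕ) : P.TG s ≤ 8 * P.Lg := by
  unfold TG
  refine max_le ?_ (Nat.div_le_self _ _)
  have := P.two_pow_le_Lg
  have : 1 ≤ P.Lg := le_trans Nat.one_le_two_pow this
  omega

/-- `8 Lg/2^s ≤ TG s`. [folklore] -/
theorem div_le_TG (s : ℕ) : 8 * P.Lg / 2 ^ s ≤ P.TG s := by unfold TG; exact le_max_right _ _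

/-- `1 ≤ XsG s`. [folklore] -/
theorem one_le_XsG (s : ℕ) : 1 ≤ P.XsG s := by unfold XsG; omega

/-- `64 (n+1) ≤ XG`. [folklore] -/
theorem sixtyfour_le_XG : 64 * (n + 1) ≤ P.XG := by unfold XG; exact le_max_right _ _

/-- `64 (n+1) ≤ XG` (real), hence `128 ≤ XG`. [folklore] -/
theorem sixtyfour_le_XG' : (64 : ℝ) * (n + 1) ≤ P.XG := by exact_mod_cast P.sixtyfour_le_XG

/-- the directional term of `XG`: `64 (n+1) W_LG/G ≤ XG`. [folklore] -/
theorem mainG_le_XG : 64 * (n + 1) * P.WLG / P.G ≤ P.XG := by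
  have h : (⌈64 * (n + 1) * P.WLG / P.G⌉₊ : ℝ) ≤ P.XG := by
    unfold XG; exact_mod_cast le_trans (le_max_left _ _) (le_max_left _ _)
  exact (Nat.le_ceil _).trans h

/-- the END term of `XG`: `(3/2)(n+1) Lg gⁿ/(C_bⁿ Ω K) ≤ XG`. [folklore] -/
theorem XE_le_XG : (3 / 2) * (n + 1) * P.Lg * P.g ^ n / (Cb ^ n * P.Ω * P.K) ≤ P.XG := by
  have h : (⌈(3 / 2) * (n + 1) * P.Lg * P.g ^ n / (Cb ^ n * P.Ω * P.K)⌉₊ : ℝ) ≤ P.XG := by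
    unfold XG; exact_mod_cast le_trans (le_max_right _ _) (le_max_left _ _)
  exact (Nat.le_ceil _).trans h

/-- `1 ≤ HG`. [folklore] -/
theorem one_le_HG : 1 ≤ P.HG := by unfold HG; exact le_max_left _ _

/-- `6 XG C_bⁿ Ω K/gⁿ ≤ L₀G < 6 XG C_bⁿ Ω K/gⁿ + 1`. [folklore] -/
theorem L0G_ge : 6 * P.XG * Cb ^ n * P.Ω * P.K / P.g ^ n ≤ P.L0G := by unfold L0G; exact Nat.le_ceil _

/-- `L₀G < 6 XG C_bⁿ Ω K/gⁿ + 1`. [folklore] -/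
theorem L0G_lt : (P.L0G : ℝ) < 6 * P.XG * Cb ^ n * P.Ω * P.K / P.g ^ n + 1 := by
  unfold L0G
  refine Nat.ceil_lt_add_one ?_
  have := P.Ω_pos; have := P.K_pos; have : (0:ℝ) < Cb := by unfold Cb cM; positivity
  have := lt_of_lt_of_le one_pos P.one_le_g
  positivity

/-! ### The orders: decrement and level laws -/

/-- the in-level decrement law `MordG s ν = MordG s (ν+1) + TG s` for `ν ≤ n`. [cite: Nesterenko2003, (4.5)] -/
theorem MordG_sub_succ (s ν : ℕ) (hν : ν ≤ n) : P.MordG s ν = P.MordG s (ν + 1) + P.TG s := by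
  unfold MordG
  have : n + 1 - ν = (n + 1 - (ν + 1)) + 1 := by omega
  rw [this]; ring

/-- `RG s = TG s + RG (s+1)` for `s ≤ ŜG`. [folklore] -/
theorem RG_eq_add (s : ℕ) (hs : s ≤ P.SdG) : P.RG s = P.TG s + P.RG (s + 1) := by
  unfold RG
  rw [← Finset.sum_Ioc_add_eq_sum_Icc hs, add_comm, Finset.Icc_add_one_left_eq_Ioc]

/-- `RG s = 0` beyond the depth. [folklore] -/
theorem RG_eq_zero (s : ℕ) (hs : P.SdG < s) : P.RG s = 0 := by
  unfold RG; rw [Finset.Icc_eq_empty (by omega), Finset.sum_empty]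

/-- the level law `MordG s (n+1) = MordG (s+1) 0` for `s < ŜG` (the Kummer step hands the order over).
[cite: Nesterenko2003, (4.5)] -/
theorem MordG_level (s : ℕ) (hs : s + 1 ≤ P.SdG) : P.MordG s (n + 1) = P.MordG (s + 1) 0 := by
  unfold MordG
  rw [P.RG_eq_add (s + 1) hs]
  simp only [Nat.sub_self, zero_mul, add_zero, Nat.sub_zero]
  ring

/-- `MG/(n+2)³ ≤ MordG s ν` (the reserved floor, = the END multiplicity). [cite: Nesterenko2003, (4.5)] -/
theorem MG_div_le_MordG (s ν : ℕ) : P.MG / (n + 2) ^ 3 ≤ P.MordG s ν := by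
  unfold MordG; omega

/-- `RG 0 ≤ 16 Lg + ŜG + 1` (geometric part `Σ 8Lg/2^s ≤ 16 Lg`, floor part `≤ ŜG + 1`). [folklore] -/
theorem RG_zero_le : P.RG 0 ≤ 16 * P.Lg + (P.SdG + 1) := by
  unfold RG TG
  have h1 : ∀ s ∈ Finset.Icc 0 P.SdG, max 1 (8 * P.Lg / 2 ^ s) ≤ 1 + 8 * P.Lg / 2 ^ s := by
    intro s _; exact max_le (Nat.le_add_right 1 _) (Nat.le_add_left _ _)
  refine (Finset.sum_le_sum h1).trans ?_
  rw [Finset.sum_add_distrib, Finset.sum_const, Nat.card_Icc, smul_eq_mul, mul_one]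
  have h2 : ∑ s ∈ Finset.Icc 0 P.SdG, 8 * P.Lg / 2 ^ s ≤ 16 * P.Lg := by
    have hr : Finset.Icc 0 P.SdG = Finset.range (P.SdG + 1) := by ext s; simp
    have hreal : ((∑ s ∈ Finset.Icc 0 P.SdG, 8 * P.Lg / 2 ^ s : ℕ) : ℝ) ≤ 16 * P.Lg := by
      rw [Nat.cast_sum]
      have hL : (0 : ℝ) ≤ P.Lg := by positivity
      calc ∑ s ∈ Finset.Icc 0 P.SdG, ((8 * P.Lg / 2 ^ s : ℕ) : ℝ)
          ≤ ∑ s ∈ Finset.Icc 0 P.SdG, (8 * (P.Lg : ℝ)) * (1 / 2) ^ s := by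
            refine Finset.sum_le_sum fun s _ => ?_
            calc ((8 * P.Lg / 2 ^ s : ℕ) : ℝ) ≤ ((8 * P.Lg : ℕ) : ℝ) / ((2 ^ s : ℕ) : ℝ) := Nat.cast_div_le
              _ = (8 * (P.Lg : ℝ)) * (1 / 2) ^ s := by push_cast; rw [one_div, inv_pow]; ring
        _ = (8 * (P.Lg : ℝ)) * ∑ s ∈ Finset.range (P.SdG + 1), (1 / 2 : ℝ) ^ s := by
            rw [← Finset.mul_sum, hr]
        _ ≤ (8 * (P.Lg : ℝ)) * 2 := mul_le_mul_of_nonneg_left (sum_geometric_two_le _) (by positivity)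
        _ = 16 * P.Lg := by ring
    exact_mod_cast hreal
  omega

/-- `MordG 0 0 = MG/(n+2)³ + (n+1) RG 0`. [folklore] -/
theorem MordG_zero_zero : P.MordG 0 0 = P.MG / (n + 2) ^ 3 + (n + 1) * P.RG 0 := by
  unfold MordG
  rw [P.RG_eq_add 0 (Nat.zero_le _)]
  simp only [Nat.sub_zero]
  ring

/-- **`MordG 0 0 ≤ MG/(n+2)³ + (n+1)(16 Lg + ŜG + 1)`** (Nesterenko's `M̂`, gain-divided, plus the floor draw).
[cite: Nesterenko2003, (3.25)] -/
theorem MordG_zero_zero_le : P.MordG 0 0 ≤ P.MG / (n + 2) ^ 3 + (n + 1) * (16 * P.Lg + (P.SdG + 1)) := by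
  rw [P.MordG_zero_zero]
  exact Nat.add_le_add_left (Nat.mul_le_mul_left _ P.RG_zero_le) _

end PadicG3Par

end Summit.ABC.StewartYu
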